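import Summits.CriticalPhenomena.Ising3D.TaylorRegionDeltaTails
import Mathlib.Tactic.Linarith
import Mathlib.Tactic.Positivity
import Mathlib.Tactic.Ring
import HarnessLib

/-!
# δ-expanded TAIL tables by an exact `P`-shift of the ROW δ-tables (no extra literals, no extra containments)
(cell `pub-ising3x`, seat recog-1 gen 14; gate (g2) — the kernel-affordable form of `TaylorRegionDeltaTails`)

HONEST FRAMING: lottery ticket; floor = tightest certified 3D Ising CFT bounds; no exact-solution claim without a
proof. Island framing: certified exclusion region at stated derivative order and assumptions; not a determination of
the 3D Ising critical exponents beyond that.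

MEASURED (recog-1 gen 14, M-g2 functional, Λ = 11, kernel): the δ-tables built AT the tail shift `ccT = 85`
(`tabOKcT` of TaylorRegionDeltaTails) are HEAVY — the order-2 containment (six `kernelPDLI2` builds with dense
`powShiftI 85` factors) takes ≈ 60–115 s of kernel time each and a certificate file holding four of them gets no
verdict on the farm (180–230 s), and the Data file with `tailSizesOKΔ` next to the other size checks exhausts memory
(each passes alone: 14 s) — whereas the ROW δ-tables (`ccQ = 0`, `tabOKc`, 16/34/72 s) are already in every
certificate. The `(P, D)` kernel table at shift `cc` is the table at shift `cc₀` re-expanded in `P`: `table_cc(P) =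
table_cc₀(P + (cc − cc₀))`, an exact polynomial SHIFT of every `D`-row (`shift2P` / `shift2PI`, linear,
kernel-cheap, sound by the landed `pmem_shiftI` / `evalR_shiftR`). So the tail `(P, D)` tables are `shift2PI S
(fullT S W TT_c) (ccT − ccQ)` of the row literals (`EvenRegionDataΔ.tailLPS` / `OddConeRegionDataΔ.tailLPS`), fed to
the landed moment rows and tail cells unchanged; value identity `qSum_eq_eval2_substMom_shift`. Exact twin on the
M-g2 functional, box half-width `4.9·10⁻⁴`: all 128 D-cells pass with `dP = 6` (interval widths ≈ 1.7× the directly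
built tables'). Assembly theorems: `taylorEvenRegion_of_splitΔLPS` / `oddCone_of_splitΔLPS`
(TaylorRegionDeltaTailsShiftEven / …Odd).
Elementary. [folklore]
-/

namespace Summit.CriticalPhenomena.Ising3D

open Finset Set
open Literature.Analysis.ValidatedNumerics Literature.Analysis.ValidatedNumerics.PolyMP
open Literature.Analysis.ValidatedNumerics.NumericsMP (MI)
open Literature.MathematicalPhysics.QuantumFieldTheory.ConformalBootstrap3D

/-! ### The `P`-shift of a `(P, D)` table -/

/-- Shift every `D`-row (a `P`-polynomial) of an interval `(P, D)` table by the rational `c`. [folklore] -/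
def shift2PI (S : ℕ) (T : IPoly2) (c : ℚ) : IPoly2 := T.map fun row => shiftI S row (ofRat S c)

/-- Real shadow. [folklore] -/
noncomputable def shift2P (G : List (List ℝ)) (c : ℝ) : List (List ℝ) := G.map fun row => shiftR row c

/-- [folklore] -/
theorem pmem2_shift2PI {S : ℕ} (hS : 0 < S) (c : ℚ) :
    ∀ {G : List (List ℝ)} {T : IPoly2}, PMem2 S G T → PMem2 S (shift2P G (c : ℝ)) (shift2PI S T c)
  | _, _, List.Forall₂.nil => by simpa [shift2P, shift2PI] using pmem2_nil S
  | _, _, List.Forall₂.cons (a := g) (b := P) (l₁ := G) (l₂ := T) hg hT => by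
      simp only [shift2P, shift2PI, List.map_cons]
      exact pmem2_cons (pmem_shiftI hS (mem_ofRat S c) hg) (pmem2_shift2PI hS c hT)

/-- [folklore] -/
theorem getD_shift2P (G : List (List ℝ)) (c : ℝ) (k : ℕ) : (shift2P G c).getD k [] = shiftR (G.getD k []) c := by
  rw [shift2P, List.getD_eq_getElem?_getD, List.getElem?_map, List.getD_eq_getElem?_getD]
  cases G[k]? with
  | none => simp [shiftR]
  | some row => simp

/-- **The q-sum over a wide box through the SHIFTED substituted δ-combined table**: with the row δ-tables at shift
`cc₀` and the tail shift `cc`,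
`q̂(E, j; s₀ + δ) = eval2 (substMom (shift2P (deltaQfull … cc₀ … δ) (cc − cc₀)) cc N R) (E − cc) (j/E)`. [folklore] -/
theorem qSum_eq_eval2_substMom_shift {S : ℕ} (hS : 0 < S) (cQ : ℕ × ℕ → ℚ) (σQ : ℚ) (s₀ : ℚ) {W : ℚ} (hW : 0 ≤ W)
    (cc₀ cc : ℚ) {l : List (ℕ × ℕ)} (hl : l.Nodup) {N R : ℕ} (hN : deltaSizeOK S cQ σQ s₀ W cc₀ l N = true)
    (hR : momLenOK N R = true) {δ : ℝ} (hδ : |δ| ≤ W) {E : ℝ} (hE : 0 < E) (j : ℕ) :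
    qSum (fun ab => (cQ ab : ℝ)) l.toFinset ((s₀ : ℝ) + δ) (σQ : ℝ) E j =
      eval2 (substMom (shift2P (deltaQfull cQ σQ s₀ cc₀ l δ) (((cc - cc₀ : ℚ)) : ℝ)) (cc : ℝ) N R) (E - cc)
        ((j : ℝ) / E) := by
  have hsize : size2 (deltaQfull cQ σQ s₀ cc₀ l δ) ≤ N := by
    rw [size2_eq_of_pmem2 (pmem2_deltaQfull hS cQ σQ s₀ hW cc₀ l hδ)]
    exact of_decide_eq_true hN
  have hQ : ∀ u v : ℝ, eval2 (deltaQfull cQ σQ s₀ cc₀ l δ) (u + v - cc₀) (u - v) =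
      evenKernel (fun ab => (cQ ab : ℝ)) l.toFinset ((s₀ : ℝ) + δ) (σQ : ℝ) u v := fun u v => by
    rw [evenKernel_eq_eval2_delta cQ σQ s₀ cc₀ hl δ u v, deltaQfull, eval2_add2, eval2_add2, eval2_smul2, eval2_smul2]
    ring
  rw [qSum_eq_evalR_qRowOfTable_of_eval2 _ _ _ _ _ _ hQ hsize E j, evalR_qRowOfTable, eval2_substMom]
  refine Finset.sum_congr rfl fun k hk => ?_
  have hcc : (((cc - cc₀ : ℚ)) : ℝ) + (E - cc) = E - cc₀ := by push_cast; ring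
  rw [getD_shift2P, evalR_shiftR, hcc, show E - (cc : ℝ) + cc = E by ring, div_mul_cancel₀ _ hE.ne',
    hMoment_eq_sum_momCoeff (momLen_of_ok hR (Finset.mem_range.mp hk)) j]

/-- **The shifted substituted real table lies in the literal `(E, θ)` table** when its rows contain the rows computed
from the shifted δ-combined ROW literals. [folklore] -/
theorem pmem2_substMom_shift {S : ℕ} (hS : 0 < S) (c : ℕ × ℕ → ℚ) (σQ s₀ : ℚ) {W : ℚ} (hW : 0 ≤ W) (cc₀ cc : ℚ)
    (l : List (ℕ × ℕ)) {T : ITab3} (hT : ∀ m : ℕ, m < 3 → tabOK S c σQ s₀ W cc₀ l T m = true) {δ : ℝ}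
    (hδ : |δ| ≤ W) (N R : ℕ) {LT : IPoly2} (hlen : LT.length = R)
    (hrows : ∀ r : ℕ, r < R →
      subsetI (substMomRowI S (shift2PI S (fullT S W T) (cc - cc₀)) cc N r) (LT.getD r []) = true) :
    PMem2 S (substMom (shift2P (deltaQfull c σQ s₀ cc₀ l δ) (((cc - cc₀ : ℚ)) : ℝ)) (cc : ℝ) N R) LT :=
  pmem2_substMom_of_rows hS (pmem2_shift2PI hS (cc - cc₀) (pmem2_fullT hS c σQ s₀ hW cc₀ l hT hδ)) cc N R hlen hrows

/-! ### Data-level: the shifted tail tables from the ROW literal δ-tables -/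

namespace EvenRegionDataΔ

variable (d : EvenRegionDataΔ)

/-- The four tail `(P, D)` tables: the δ-combined ROW tables shifted to the tail variable `P = E − ccT`. [folklore] -/
def tailLPS (TT : ITab3 × ITab3 × ITab3 × ITab3) : IPoly2 × IPoly2 × IPoly2 × IPoly2 :=
  (shift2PI d.S (fullT d.S d.Wσ TT.1) (d.ccT - d.ccQ), shift2PI d.S (fullT d.S d.Wε TT.2.1) (d.ccT - d.ccQ),
    shift2PI d.S (fullT d.S d.Wb TT.2.2.1) (d.ccT - d.ccQ), shift2PI d.S (fullT d.S d.Wb TT.2.2.2) (d.ccT - d.ccQ))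

end EvenRegionDataΔ

namespace OddConeRegionDataΔ

variable (d : OddConeRegionDataΔ)

/-- The five tail `(P, D)` tables: the δ-combined ROW tables shifted to `P = E − ccT`. [folklore] -/
def tailLPS (TT : ITab3x5) : IPoly2x5 :=
  (shift2PI d.S (fullT d.S d.Wb TT.1) (d.ccT - d.ccQ), shift2PI d.S (fullT d.S d.Wσ TT.2.1) (d.ccT - d.ccQ),
    shift2PI d.S (fullT d.S d.Wσ TT.2.2.1) (d.ccT - d.ccQ), shift2PI d.S (fullT d.S 0 TT.2.2.2.1) (d.ccT - d.ccQ),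
    shift2PI d.S (fullT d.S d.Wt TT.2.2.2.2) (d.ccT - d.ccQ))

end OddConeRegionDataΔ

end Summit.CriticalPhenomena.Ising3D
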